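import Mathlib
import Literature.Computability.MetaComplexity.SmolenskyDimensionBound
import Literature.Computability.MetaComplexity.TruthTables
import Literature.NumberTheory.LFunctions.MoebiusWalshCircuitsACdProofs

/-!
# The shift inequality of annihilator ranks

Wave-4 support of line Sketch/LAR of crux stmt-QuantumAdvantage-1392 (`DigitPolyUniformity`,
route `MobiusLadder`) — the step that makes the transferred crux one set / one clause. Number the
Boolean cube `{0,1}ⁿ` by `val_n b = boolFunEquivFin n b ∈ [0, 2ⁿ)` (binary, least significant
bit first) and write `λ` for the Liouville function. The annihilators of the set
`{b : λ(val_n b) ≠ −1}` among the polynomials of degree `≤ k` on `n` bits inject, through the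
shift map `g ↦ (b ↦ [b₀ = 0] · g(b₁, …, b_n))` and `λ(2m) = −λ(m)`, into the annihilators of
`{b : λ(val_{n+1} b) = −1}` among the polynomials of degree `≤ k + 1` on `n + 1` bits; hence

  `dim (lowDeg n k ⊓ {g : g = 0 on {λ(val_n ·) ≠ −1}})`
    `≤ dim (lowDeg (n+1) (k+1) ⊓ {h : h = 0 on {λ(val_{n+1} ·) = −1}})`.

The vanishing conditions are rendered definition-free as the kernels of the restriction maps
`LinearMap.funLeft _ _ (Subtype.val : {b // p b} → _)`. The two cube-specific ingredients — the
shift map raises the degree by at most one (`hmem`), and `val_{n+1} b = [b₀] + 2 · val_n(b₁, …, b_n)`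
(`hval`) — are hypotheses, supplied by the neighbouring stubs at composition time;
`λ(2m) = −λ(m)` is the tree's `Literature.NumberTheory.LFunctions.Green2012.liouville_two_mul`
(complete multiplicativity of `λ` and `λ(2) = −1`).

Proof: the shift map `L` is linear and injective (evaluate `L g` at `(0, b')` to recover `g b'`),
maps `lowDeg n k` into `lowDeg (n+1) (k+1)` (`hmem`), and maps functions vanishing on
`{λ(val_n ·) ≠ −1}` to functions vanishing on `{λ(val_{n+1} ·) = −1}`: at a point `b` with
`λ(val_{n+1} b) = −1`, either `b₀ = 1` and the prefactor `[b₀ = 0]` vanishes, or `b₀ = 0` and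
`val_{n+1} b = 2 · val_n b'` (`b' = (b₁, …, b_n)`), so `−1 = λ(2 · val_n b') = −λ(val_n b')`
forces `λ(val_n b') = 1 ≠ −1` and `g b' = 0`. An injective linear map between the two
intersections gives the inequality of dimensions (standard linear algebra).
-/

namespace Summit.QuantumAdvantage.DigitPolyUniformity.SketchLAR

open Finset Module
open Literature.Computability.MetaComplexity (boolFunEquivFin)
open Literature.Computability.MetaComplexity.Smolensky (CubeFn mono lowDeg)

namespace ShiftFinrank

/-- A linear map sending a subspace `S` into a subspace `T` of a finite-dimensional space and
injective on `S` gives `dim S ≤ dim T`. [folklore] -/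
theorem finrank_le_of_mapsTo {F : Type*} [Field F] {V W : Type*} [AddCommGroup V] [Module F V]
    [AddCommGroup W] [Module F W] [FiniteDimensional F W] (L : V →ₗ[F] W) (S : Submodule F V)
    (T : Submodule F W) (hmaps : ∀ v ∈ S, L v ∈ T) (hinj : ∀ v ∈ S, L v = 0 → v = 0) :
    Module.finrank F ↥S ≤ Module.finrank F ↥T := by
  let f : ↥S →ₗ[F] ↥T := (L.domRestrict S).codRestrict T fun v => hmaps v.1 v.2
  refine LinearMap.finrank_le_finrank_of_injective (f := f) ?_
  refine (injective_iff_map_eq_zero f).2 fun v hv => ?_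
  have h : L v.1 = 0 := congrArg Subtype.val hv
  exact Subtype.ext (hinj v.1 v.2 h)

end ShiftFinrank

/-- **The shift inequality of annihilator ranks** (definition-free form). Over `GF(2)`, with the
cube `{0,1}ⁿ` numbered by `val_n = boolFunEquivFin n` and `λ` the Liouville function: granted that
the shift map `g ↦ (b ↦ [b₀ = 0] · g(b₁, …, b_n))` sends `lowDeg n k` into `lowDeg (n+1) (k+1)`
(`hmem`) and that `val_{n+1} b = [b₀] + 2 · val_n(b₁, …, b_n)` (`hval`), the dimension of the
space of degree-`≤ k` polynomials on `n` bits vanishing wherever `λ(val_n ·) ≠ −1` is at most the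
dimension of the space of degree-`≤ k + 1` polynomials on `n + 1` bits vanishing wherever
`λ(val_{n+1} ·) = −1` (the shift map is injective and, by `λ(2m) = −λ(m)`, maps the former space
into the latter). [folklore] -/
theorem stub_shift_finrank {n k : ℕ}
    (hmem : ∀ g : CubeFn (ZMod 2) n, g ∈ lowDeg (ZMod 2) n k →
      (fun b : Fin (n + 1) → Bool => (if b 0 then (0 : ZMod 2) else 1) * g (fun i => b i.succ)) ∈
        lowDeg (ZMod 2) (n + 1) (k + 1))
    (hval : ∀ b : Fin (n + 1) → Bool, ((boolFunEquivFin (n + 1) b : Fin (2 ^ (n + 1))) : ℕ) =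
      (if b 0 then 1 else 0) + 2 * ((boolFunEquivFin n (fun i => b i.succ) : Fin (2 ^ n)) : ℕ)) :
    Module.finrank (ZMod 2) ↥(lowDeg (ZMod 2) n k ⊓
        LinearMap.ker (LinearMap.funLeft (ZMod 2) (ZMod 2) (Subtype.val :
          {b : Fin n → Bool // ArithmeticFunction.liouville ((boolFunEquivFin n b : Fin (2 ^ n)) : ℕ) ≠ -1} →
            (Fin n → Bool)))) ≤
      Module.finrank (ZMod 2) ↥(lowDeg (ZMod 2) (n + 1) (k + 1) ⊓
        LinearMap.ker (LinearMap.funLeft (ZMod 2) (ZMod 2) (Subtype.val :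
          {b : Fin (n + 1) → Bool //
              ArithmeticFunction.liouville ((boolFunEquivFin (n + 1) b : Fin (2 ^ (n + 1))) : ℕ) = -1} →
            (Fin (n + 1) → Bool)))) := by
  -- membership in the kernel of a restriction map = vanishing at the selected points
  have hker : ∀ {m : ℕ} {p : (Fin m → Bool) → Prop} {h : CubeFn (ZMod 2) m},
      h ∈ LinearMap.ker (LinearMap.funLeft (ZMod 2) (ZMod 2) (Subtype.val : {b // p b} → (Fin m → Bool))) ↔
        ∀ b, p b → h b = 0 := by
    intro m p h
    rw [LinearMap.mem_ker, funext_iff]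
    exact ⟨fun H b hb => H ⟨b, hb⟩, fun H y => H y.1 y.2⟩
  -- the shift map `L g = (b ↦ [b₀ = 0] · g(b₁, …, b_n))`
  let u : CubeFn (ZMod 2) (n + 1) := fun b => if b 0 then (0 : ZMod 2) else 1
  let t : (Fin (n + 1) → Bool) → (Fin n → Bool) := fun b i => b i.succ
  let L : CubeFn (ZMod 2) n →ₗ[ZMod 2] CubeFn (ZMod 2) (n + 1) :=
    (LinearMap.mulLeft (ZMod 2) u).comp (LinearMap.funLeft (ZMod 2) (ZMod 2) t)
  have hL : ∀ (g : CubeFn (ZMod 2) n) (b : Fin (n + 1) → Bool),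
      L g b = (if b 0 then (0 : ZMod 2) else 1) * g (fun i => b i.succ) := fun g b => rfl
  refine ShiftFinrank.finrank_le_of_mapsTo L _ _ (fun g hg => ?_) (fun g _ hg0 => ?_)
  · -- `L` maps the source intersection into the target intersection
    obtain ⟨hgdeg, hgker⟩ := Submodule.mem_inf.1 hg
    refine Submodule.mem_inf.2 ⟨?_, hker.2 fun b hb => ?_⟩
    · -- degree: `hmem`
      have h := hmem g hgdeg
      have hLg : L g = fun b : Fin (n + 1) → Bool =>
          (if b 0 then (0 : ZMod 2) else 1) * g (fun i => b i.succ) := funext (hL g)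
      rw [hLg]
      exact h
    · -- vanishing on `{λ(val_{n+1} ·) = −1}`
      rw [hL]
      cases h0 : b 0
      · -- `b₀ = 0`: `val_{n+1} b = 2 · val_n b'`, so `λ(val_n b') = 1 ≠ −1` and `g b' = 0`
        have hv := hval b
        rw [h0] at hv
        simp only [Bool.false_eq_true, if_false, zero_add] at hv
        rw [hv, Literature.NumberTheory.LFunctions.Green2012.liouville_two_mul] at hb
        have hne : ArithmeticFunction.liouville
            ((boolFunEquivFin n (fun i => b i.succ) : Fin (2 ^ n)) : ℕ) ≠ -1 := by
          rw [neg_inj.1 hb]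
          decide
        rw [(hker.1 hgker) _ hne, mul_zero]
      · -- `b₀ = 1`: the prefactor vanishes
        simp
  · -- `L` is injective: evaluate at `(0, b')`
    funext b'
    have h := congrFun hg0 (Fin.cons false b')
    rw [hL, Pi.zero_apply] at h
    simpa only [Fin.cons_zero, Fin.cons_succ, Bool.false_eq_true, if_false, one_mul,
      Pi.zero_apply] using h

end Summit.QuantumAdvantage.DigitPolyUniformity.SketchLAR
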